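import Literature.MathematicalPhysics.QuantumManyBody.DiluteBoseGasUpperBound
import Mathlib.MeasureTheory.Integral.IntegralEqImproper
import Mathlib.MeasureTheory.Constructions.HaarToSphere
import Mathlib.MeasureTheory.Measure.Lebesgue.VolumeOfBalls
import Mathlib.Analysis.SpecialFunctions.Sqrt
import Mathlib.Analysis.SpecialFunctions.Pow.Real
import HarnessLib

/-!
# The Lee–Huang–Yang integral: `½(2π)⁻³ ∫ (√(p⁴+16πρa p²) - p² - 8πρa + (8πρa)²/(2p²)) dp = 4πρ²a · (128/(15√π)) √(ρa³)`

Topic `Literature/MathematicalPhysics/QuantumManyBody` (provefact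
`Literature.MathematicalPhysics.QuantumManyBody.BoseGas.Junge2026_neumannBox_pinnedLowerBound`: the
Lee–Huang–Yang constant `128/(15√π)` of Junge's Theorem 4 / [FournaisEtAl2024, Thm. 1.3] enters
the printed proof through the Bogoliubov ground-state energy, [FournaisEtAl2024, Cor. 2.13 and
Lemma 8.1]: "it is a standard result that `∫_{ℝ³} p² G(8πρ_z a/p²) dp = 64π⁴ (128/(15√π)) (ρ_z a)^{5/2}`
(see for instance [FS])", `G(t) = √(1+2t) - 1 - t + t²/2 ≥ 0`, `x G(y/x) = √(x²+2xy) - x - y + y²/(2x)`;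
the minus sign printed in front of `64π⁴` there is a typo, both sides being positive). This is
the second-order term of `e(ρ) = 4πρ²a(1 + (128/(15√π))√(ρa³) + …)` (Lee–Huang–Yang 1957; the
constant `lhyConstant` of `DiluteBoseGasUpperBound.lean`). This file PROVES the integral:

* `integral_lhy_one_dim` — `∫₀^∞ (q³√(q²+2) - q⁴ - q² + ½) dq = 8√2/15`, by the primitive
  `F(q) = √(q²+2)((q²+2)²/5 - ⅔(q²+2)) - q⁵/5 - q³/3 + q/2` (`hasDerivAt_lhyPrimitive`,
  `F(0) = -8√2/15`, `F → 0` at infinity by `F = (A-B)/15`, `A² - B² = -45q⁴ - (225/4)q² + 128`),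
  the integrand being positive (`lhyIntegrand_pos`), so that the improper integral is the limit
  of the primitive (`MeasureTheory.integral_Ioi_of_hasDerivAt_of_nonneg'`); integrability
  `integrableOn_lhy_one_dim`;
* `integral_bogoliubov_radial`, `integral_bogoliubov` — for `μ > 0`,
  `∫_{ℝ³} (√(|p|⁴+2μ|p|²) - |p|² - μ + μ²/(2|p|²)) dp = (32√2π/15) μ^{5/2}` (polar coordinates,
  `MeasureTheory.integral_fun_norm_addHaar`, and the scaling `p = √μ q`), with integrability
  `integrable_bogoliubov`;
* `lhy_correction_integral` — with `μ = 8πρa`: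
  `½(2π)⁻³ ∫_{ℝ³} (√(|p|⁴+16πρa|p|²) - |p|² - 8πρa + (8πρa)²/(2|p|²)) dp = 4πρ²a · lhyConstant · √(ρa³)`,
  i.e. minus one half of the Bogoliubov sum `∑(p² + 8πρa - √(p⁴+16πρap²) - (8πρa)²/(2p²))` per unit
  volume in the thermodynamic limit is the Lee–Huang–Yang correction.

No new definitions (the integrands are written out; momenta in the convention `ħ = 2m = 1` of the
topic, `(2π)⁻³dp`).

## References

* [FournaisEtAl2024] S. Fournais, L. Junge, T. Girardot, L. Morin, M. Olivieri, A. Triay, *The free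
  energy of dilute Bose gases at low temperatures interacting via strong potentials*,
  arXiv:2408.14222, Ann. Henri Poincaré (2026): Cor. 2.13, Lemma 8.1 and its proof.
* [FournaisSolovej2020] S. Fournais, J. P. Solovej, *The energy of dilute Bose gases*, Ann. of
  Math. 192 (2020) 893–976 (the reference "[FS]" for the integral).
* [BastiCenatiempoSchlein2021] (via `DiluteBoseGasUpperBound.lean`): the constant `128/(15√π)`, (1.2).
* T. D. Lee, K. Huang, C. N. Yang, Phys. Rev. 106 (1957) 1135–1145 (the original formula).
-/

noncomputable section

open MeasureTheory Set Filter Topology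

namespace Literature.MathematicalPhysics.QuantumManyBody.BoseGas

/-! ### The primitive of the one-dimensional integrand -/

/-- `d/dq √(q²+2) = q/√(q²+2)`. [folklore] -/
theorem hasDerivAt_sqrt_sq_add_two (q : ℝ) :
    HasDerivAt (fun x => Real.sqrt (x ^ 2 + 2)) (q / Real.sqrt (q ^ 2 + 2)) q := by
  have hu : HasDerivAt (fun x : ℝ => x ^ 2 + 2) (2 * q) q := by
    simpa using (hasDerivAt_pow 2 q).add_const 2
  have hpos : 0 < q ^ 2 + 2 := by positivity
  convert hu.sqrt hpos.ne' using 1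
  field_simp

/-- `d/dq [√(q²+2)((q²+2)²/5 - ⅔(q²+2))] = q³√(q²+2)` (the primitive of `q³√(q²+2)`,
i.e. `(q²+2)^{5/2}/5 - ⅔(q²+2)^{3/2}`). [folklore] -/
theorem hasDerivAt_lhyPrimitive_sqrt (q : ℝ) :
    HasDerivAt (fun x => Real.sqrt (x ^ 2 + 2) * ((x ^ 2 + 2) ^ 2 / 5 - 2 / 3 * (x ^ 2 + 2)))
      (q ^ 3 * Real.sqrt (q ^ 2 + 2)) q := by
  have hs := hasDerivAt_sqrt_sq_add_two q
  have hu : HasDerivAt (fun x : ℝ => x ^ 2 + 2) (2 * q) q := by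
    simpa using (hasDerivAt_pow 2 q).add_const 2
  have hP : HasDerivAt (fun x : ℝ => (x ^ 2 + 2) ^ 2 / 5 - 2 / 3 * (x ^ 2 + 2))
      (↑(2 : ℕ) * (q ^ 2 + 2) ^ (2 - 1) * (2 * q) / 5 - 2 / 3 * (2 * q)) q :=
    ((hu.pow 2).div_const 5).sub (hu.const_mul (2 / 3 : ℝ))
  have h : HasDerivAt (fun x => Real.sqrt (x ^ 2 + 2) * ((x ^ 2 + 2) ^ 2 / 5 - 2 / 3 * (x ^ 2 + 2)))
      (q / Real.sqrt (q ^ 2 + 2) * ((q ^ 2 + 2) ^ 2 / 5 - 2 / 3 * (q ^ 2 + 2)) +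
        Real.sqrt (q ^ 2 + 2) *
          (↑(2 : ℕ) * (q ^ 2 + 2) ^ (2 - 1) * (2 * q) / 5 - 2 / 3 * (2 * q))) q :=
    hs.mul hP
  refine h.congr_deriv ?_
  set s := Real.sqrt (q ^ 2 + 2) with hs_def
  have hs0 : 0 < s := Real.sqrt_pos.2 (by positivity)
  have hs2 : s ^ 2 = q ^ 2 + 2 := Real.sq_sqrt (by positivity)
  push_cast
  simp only [pow_one]
  field_simp
  linear_combination (4 * q - 3 * q ^ 3) * hs2

/-- **The primitive** `F(q) = √(q²+2)((q²+2)²/5 - ⅔(q²+2)) - q⁵/5 - q³/3 + q/2` has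
`F'(q) = q³√(q²+2) - q⁴ - q² + ½`. [folklore] -/
theorem hasDerivAt_lhyPrimitive (q : ℝ) :
    HasDerivAt (fun x => Real.sqrt (x ^ 2 + 2) * ((x ^ 2 + 2) ^ 2 / 5 - 2 / 3 * (x ^ 2 + 2))
        - x ^ 5 / 5 - x ^ 3 / 3 + x / 2)
      (q ^ 3 * Real.sqrt (q ^ 2 + 2) - q ^ 4 - q ^ 2 + 1 / 2) q := by
  have h1 := hasDerivAt_lhyPrimitive_sqrt q
  have h2 : HasDerivAt (fun x : ℝ => x ^ 5 / 5) (↑(5 : ℕ) * q ^ (5 - 1) / 5) q :=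
    (hasDerivAt_pow 5 q).div_const 5
  have h3 : HasDerivAt (fun x : ℝ => x ^ 3 / 3) (↑(3 : ℕ) * q ^ (3 - 1) / 3) q :=
    (hasDerivAt_pow 3 q).div_const 3
  have h4 : HasDerivAt (fun x : ℝ => x / 2) (1 / 2) q := (hasDerivAt_id q).div_const 2
  refine (((h1.sub h2).sub h3).add h4).congr_deriv ?_
  push_cast
  ring

/-- `F(0) = -8√2/15`. [folklore] -/
theorem lhyPrimitive_zero :
    Real.sqrt ((0 : ℝ) ^ 2 + 2) * (((0 : ℝ) ^ 2 + 2) ^ 2 / 5 - 2 / 3 * ((0 : ℝ) ^ 2 + 2))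
        - (0 : ℝ) ^ 5 / 5 - (0 : ℝ) ^ 3 / 3 + 0 / 2 = -(8 * Real.sqrt 2 / 15) := by
  norm_num
  ring

/-- **The integrand is positive**: `q³√(q²+2) - q⁴ - q² + ½ > 0` for `q ≥ 0` (for `q ≤ ½` because
`q⁴ + q² < ½`; for `q > ½` because `q⁶(q²+2) - (q⁴+q²-½)² = q² - ¼ > 0`). [folklore] -/
theorem lhyIntegrand_pos (q : ℝ) (hq : 0 ≤ q) :
    0 < q ^ 3 * Real.sqrt (q ^ 2 + 2) - q ^ 4 - q ^ 2 + 1 / 2 := by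
  set s := Real.sqrt (q ^ 2 + 2) with hs_def
  have hs0 : 0 < s := Real.sqrt_pos.2 (by positivity)
  have hs2 : s ^ 2 = q ^ 2 + 2 := Real.sq_sqrt (by positivity)
  rcases le_or_gt q (1 / 2) with h | h
  · have h1 : q ^ 4 + q ^ 2 < 1 / 2 := by
      nlinarith [pow_le_pow_left₀ hq h 2, pow_le_pow_left₀ hq h 4]
    have h2 : 0 ≤ q ^ 3 * s := by positivity
    linarith
  · by_contra hcon
    have hle : q ^ 3 * s ≤ q ^ 4 + q ^ 2 - 1 / 2 := by linarith [not_lt.1 hcon]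
    have hsq : (q ^ 3 * s) ^ 2 ≤ (q ^ 4 + q ^ 2 - 1 / 2) ^ 2 :=
      pow_le_pow_left₀ (by positivity) hle 2
    have : (q ^ 3 * s) ^ 2 = q ^ 6 * (q ^ 2 + 2) := by rw [mul_pow, hs2]; ring
    nlinarith

/-- **The primitive vanishes at infinity**: writing `F = (A - B)/15` with
`A = √(q²+2)(q²+2)(3q²-4)`, `B = 3q⁵ + 5q³ - (15/2)q`, one has `A² - B² = -45q⁴ - (225/4)q² + 128`,
so `|F(q)| ≤ 2/q` for `q ≥ 4`. [folklore] -/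
theorem tendsto_lhyPrimitive_atTop :
    Tendsto (fun x : ℝ => Real.sqrt (x ^ 2 + 2) * ((x ^ 2 + 2) ^ 2 / 5 - 2 / 3 * (x ^ 2 + 2))
        - x ^ 5 / 5 - x ^ 3 / 3 + x / 2) atTop (𝓝 0) := by
  have hbound : ∀ q : ℝ, 4 ≤ q →
      |Real.sqrt (q ^ 2 + 2) * ((q ^ 2 + 2) ^ 2 / 5 - 2 / 3 * (q ^ 2 + 2))
        - q ^ 5 / 5 - q ^ 3 / 3 + q / 2| ≤ 2 / q := by
    intro q hq
    set s := Real.sqrt (q ^ 2 + 2) with hs_def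
    have hq0 : 0 < q := by linarith
    have hs0 : 0 < s := Real.sqrt_pos.2 (by positivity)
    have hs2 : s ^ 2 = q ^ 2 + 2 := Real.sq_sqrt (by positivity)
    set A := s * (q ^ 2 + 2) * (3 * q ^ 2 - 4) with hA
    set B := 3 * q ^ 5 + 5 * q ^ 3 - 15 / 2 * q with hB
    have hF : Real.sqrt (q ^ 2 + 2) * ((q ^ 2 + 2) ^ 2 / 5 - 2 / 3 * (q ^ 2 + 2))
        - q ^ 5 / 5 - q ^ 3 / 3 + q / 2 = (A - B) / 15 := by
      rw [hA, hB]; ring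
    have h3q : 0 < 3 * q ^ 2 - 4 := by nlinarith
    have hA0 : 0 < A := by rw [hA]; exact mul_pos (mul_pos hs0 (by positivity)) h3q
    have hB0 : 3 * q ^ 5 ≤ B := by rw [hB]; nlinarith
    have hB0' : 0 < B := lt_of_lt_of_le (by positivity) hB0
    have hAB : A - B = (A ^ 2 - B ^ 2) / (A + B) := by
      field_simp
      ring
    have hA2 : A ^ 2 = (q ^ 2 + 2) ^ 3 * (3 * q ^ 2 - 4) ^ 2 := by
      rw [hA, mul_pow, mul_pow, hs2]; ring
    have hdiff : A ^ 2 - B ^ 2 = -45 * q ^ 4 - 225 / 4 * q ^ 2 + 128 := by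
      rw [hA2, hB]; ring
    have hnum : |A ^ 2 - B ^ 2| ≤ 50 * q ^ 4 := by
      rw [hdiff, abs_le]
      constructor <;> nlinarith [pow_le_pow_left₀ (by norm_num : (0 : ℝ) ≤ 4) hq 2,
        pow_le_pow_left₀ (by norm_num : (0 : ℝ) ≤ 4) hq 4]
    rw [hF, hAB, abs_div, abs_div, abs_of_pos (by positivity : (0 : ℝ) < 15),
      abs_of_pos (by positivity : 0 < A + B)]
    rw [div_div, div_le_div_iff₀ (by positivity) hq0]
    calc |A ^ 2 - B ^ 2| * q ≤ 50 * q ^ 4 * q := by gcongr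
      _ = 50 * q ^ 5 := by ring
      _ ≤ 2 * ((A + B) * 15) := by nlinarith
  have h2q : Tendsto (fun q : ℝ => 2 / q) atTop (𝓝 0) :=
    tendsto_const_nhds.div_atTop tendsto_id
  refine squeeze_zero_norm' ?_ h2q
  filter_upwards [eventually_ge_atTop (4 : ℝ)] with q hq
  rw [Real.norm_eq_abs]
  exact hbound q hq

/-! ### The one-dimensional integral -/

/-- **`∫₀^∞ (q³√(q²+2) - q⁴ - q² + ½) dq = 8√2/15`** (the radial Lee–Huang–Yang integral,
`= ∫₀^∞ q⁴ G(1/q²) dq` with `G(t) = √(1+2t) - 1 - t + t²/2`). [folklore] -/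
theorem integral_lhy_one_dim :
    ∫ q in Ioi (0 : ℝ), (q ^ 3 * Real.sqrt (q ^ 2 + 2) - q ^ 4 - q ^ 2 + 1 / 2) =
      8 * Real.sqrt 2 / 15 := by
  rw [integral_Ioi_of_hasDerivAt_of_nonneg' (a := 0) (fun x _ => hasDerivAt_lhyPrimitive x)
    (fun x hx => (lhyIntegrand_pos x (le_of_lt hx)).le) tendsto_lhyPrimitive_atTop,
    lhyPrimitive_zero]
  ring

/-- The radial Lee–Huang–Yang integrand is integrable on `(0, ∞)`. [folklore] -/
theorem integrableOn_lhy_one_dim :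
    IntegrableOn (fun q : ℝ => q ^ 3 * Real.sqrt (q ^ 2 + 2) - q ^ 4 - q ^ 2 + 1 / 2) (Ioi 0) :=
  integrableOn_Ioi_deriv_of_nonneg' (a := 0) (fun x _ => hasDerivAt_lhyPrimitive x)
    (fun x hx => (lhyIntegrand_pos x (le_of_lt hx)).le) tendsto_lhyPrimitive_atTop

/-! ### Scaling and polar coordinates: the Bogoliubov integral on `ℝ³` -/

/-- The scaling `y = √μ x` of the radial Bogoliubov integrand:
`y²(√(y⁴+2μy²) - y² - μ + μ²/(2y²)) = μ²(x³√(x²+2) - x⁴ - x² + ½)` for `x > 0`. [folklore] -/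
theorem bogoliubov_radial_scaling {μ : ℝ} (hμ : 0 < μ) {x : ℝ} (hx : 0 < x) :
    (Real.sqrt μ * x) ^ 2 * (Real.sqrt ((Real.sqrt μ * x) ^ 4 + 2 * μ * (Real.sqrt μ * x) ^ 2)
      - (Real.sqrt μ * x) ^ 2 - μ + μ ^ 2 / (2 * (Real.sqrt μ * x) ^ 2)) =
      μ ^ 2 * (x ^ 3 * Real.sqrt (x ^ 2 + 2) - x ^ 4 - x ^ 2 + 1 / 2) := by
  have hsμ : Real.sqrt μ ^ 2 = μ := Real.sq_sqrt hμ.le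
  have hsμ0 : 0 < Real.sqrt μ := Real.sqrt_pos.2 hμ
  have hx0 : x ≠ 0 := hx.ne'
  have h4 : (Real.sqrt μ * x) ^ 4 + 2 * μ * (Real.sqrt μ * x) ^ 2 =
      (μ * x) ^ 2 * (x ^ 2 + 2) := by
    rw [mul_pow, mul_pow, show Real.sqrt μ ^ 4 = (Real.sqrt μ ^ 2) ^ 2 by ring, hsμ]; ring
  have hroot : Real.sqrt ((Real.sqrt μ * x) ^ 4 + 2 * μ * (Real.sqrt μ * x) ^ 2) =
      μ * x * Real.sqrt (x ^ 2 + 2) := by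
    rw [h4, Real.sqrt_mul (sq_nonneg _), Real.sqrt_sq (by positivity)]
  rw [hroot, mul_pow, hsμ]
  field_simp

/-- **The radial Bogoliubov integral**:
`∫₀^∞ y²(√(y⁴+2μy²) - y² - μ + μ²/(2y²)) dy = (8√2/15) μ^{5/2}` (`μ > 0`). [folklore] -/
theorem integral_bogoliubov_radial {μ : ℝ} (hμ : 0 < μ) :
    ∫ y in Ioi (0 : ℝ), y ^ 2 * (Real.sqrt (y ^ 4 + 2 * μ * y ^ 2) - y ^ 2 - μ +
        μ ^ 2 / (2 * y ^ 2)) = 8 * Real.sqrt 2 / 15 * μ ^ 2 * Real.sqrt μ := by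
  have hsμ0 : 0 < Real.sqrt μ := Real.sqrt_pos.2 hμ
  have hsub := integral_comp_mul_left_Ioi
    (fun y => y ^ 2 * (Real.sqrt (y ^ 4 + 2 * μ * y ^ 2) - y ^ 2 - μ + μ ^ 2 / (2 * y ^ 2)))
    0 hsμ0
  rw [mul_zero] at hsub
  have hleft : ∫ x in Ioi (0 : ℝ), (fun y => y ^ 2 * (Real.sqrt (y ^ 4 + 2 * μ * y ^ 2) - y ^ 2
      - μ + μ ^ 2 / (2 * y ^ 2))) (Real.sqrt μ * x) = μ ^ 2 * (8 * Real.sqrt 2 / 15) := by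
    rw [← integral_lhy_one_dim, ← integral_const_mul]
    refine setIntegral_congr_fun measurableSet_Ioi fun x hx => ?_
    exact bogoliubov_radial_scaling hμ hx
  rw [hleft, smul_eq_mul] at hsub
  have : ∫ y in Ioi (0 : ℝ), y ^ 2 * (Real.sqrt (y ^ 4 + 2 * μ * y ^ 2) - y ^ 2 - μ +
      μ ^ 2 / (2 * y ^ 2)) = Real.sqrt μ * (μ ^ 2 * (8 * Real.sqrt 2 / 15)) := by
    rw [hsub, ← mul_assoc, mul_inv_cancel₀ hsμ0.ne', one_mul]
  rw [this]; ring

/-- The radial Bogoliubov integrand `y²(√(y⁴+2μy²) - y² - μ + μ²/(2y²))` is integrable on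
`(0, ∞)`. [folklore] -/
theorem integrableOn_bogoliubov_radial {μ : ℝ} (hμ : 0 < μ) :
    IntegrableOn (fun y : ℝ => y ^ 2 * (Real.sqrt (y ^ 4 + 2 * μ * y ^ 2) - y ^ 2 - μ +
      μ ^ 2 / (2 * y ^ 2))) (Ioi 0) := by
  have hsμ0 : 0 < Real.sqrt μ := Real.sqrt_pos.2 hμ
  have h := integrableOn_Ioi_comp_mul_left_iff (fun y : ℝ => y ^ 2 *
    (Real.sqrt (y ^ 4 + 2 * μ * y ^ 2) - y ^ 2 - μ + μ ^ 2 / (2 * y ^ 2))) 0 hsμ0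
  rw [mul_zero] at h
  refine h.1 ?_
  have h1 : IntegrableOn (fun x : ℝ => μ ^ 2 * (x ^ 3 * Real.sqrt (x ^ 2 + 2) - x ^ 4 - x ^ 2 +
      1 / 2)) (Ioi 0) := integrableOn_lhy_one_dim.const_mul (μ ^ 2)
  refine h1.congr_fun ?_ measurableSet_Ioi
  intro x hx
  exact (bogoliubov_radial_scaling hμ hx).symm

open Module in
/-- **The Bogoliubov integral on `ℝ³`**: for `μ > 0`,
`∫_{ℝ³} (√(|p|⁴+2μ|p|²) - |p|² - μ + μ²/(2|p|²)) dp = (32√2π/15) μ^{5/2}`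
(polar coordinates and the scaling `p = √μ q`; equivalently `∫ p²G(μ/p²)dp` with
`G(t) = √(1+2t) - 1 - t + t²/2`). [cite: FournaisEtAl2024, Lemma 8.1 (proof)] -/
theorem integral_bogoliubov {μ : ℝ} (hμ : 0 < μ) :
    ∫ p : Space, (Real.sqrt (‖p‖ ^ 4 + 2 * μ * ‖p‖ ^ 2) - ‖p‖ ^ 2 - μ + μ ^ 2 / (2 * ‖p‖ ^ 2)) =
      32 * Real.sqrt 2 * Real.pi / 15 * μ ^ 2 * Real.sqrt μ := by
  have hpolar := integral_fun_norm_addHaar (volume : Measure Space)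
    (fun r => Real.sqrt (r ^ 4 + 2 * μ * r ^ 2) - r ^ 2 - μ + μ ^ 2 / (2 * r ^ 2))
  rw [hpolar, finrank_euclideanSpace_fin]
  simp only [Nat.add_one_sub_one, smul_eq_mul, nsmul_eq_mul, Nat.cast_ofNat]
  rw [measureReal_def, EuclideanSpace.volume_ball_fin_three, integral_bogoliubov_radial hμ,
    ENNReal.toReal_mul, ← ENNReal.ofReal_pow zero_le_one, one_pow,
    ENNReal.toReal_ofReal zero_le_one, ENNReal.toReal_ofReal (by positivity)]
  ring

open Module in
/-- The Bogoliubov integrand on `ℝ³` is integrable (`μ > 0`). [folklore] -/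
theorem integrable_bogoliubov {μ : ℝ} (hμ : 0 < μ) :
    Integrable (fun p : Space =>
      Real.sqrt (‖p‖ ^ 4 + 2 * μ * ‖p‖ ^ 2) - ‖p‖ ^ 2 - μ + μ ^ 2 / (2 * ‖p‖ ^ 2)) := by
  have h := integrable_fun_norm_addHaar (volume : Measure Space)
    (f := fun r => Real.sqrt (r ^ 4 + 2 * μ * r ^ 2) - r ^ 2 - μ + μ ^ 2 / (2 * r ^ 2))
  rw [finrank_euclideanSpace_fin] at h
  simp only [Nat.add_one_sub_one, smul_eq_mul] at h
  exact h.2 (integrableOn_bogoliubov_radial hμ)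

/-! ### The Lee–Huang–Yang correction -/

/-- The scalar bookkeeping `½(2π)⁻³ · (32√2π/15)(8πρa)²√(8πρa) = 4πρ²a · (128/(15√π)) · √(ρa³)`.
[folklore] -/
theorem lhy_scalar_identity {ρ a : ℝ} (hρ : 0 < ρ) (ha : 0 < a) :
    1 / 2 * ((2 * Real.pi) ^ 3)⁻¹ * (32 * Real.sqrt 2 * Real.pi / 15 * (8 * Real.pi * ρ * a) ^ 2 *
      Real.sqrt (8 * Real.pi * ρ * a)) =
      4 * Real.pi * ρ ^ 2 * a * lhyConstant * Real.sqrt (ρ * a ^ 3) := by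
  have hpi := Real.pi_pos
  have h8 : Real.sqrt (8 * Real.pi * ρ * a) =
      2 * Real.sqrt 2 * Real.sqrt Real.pi * Real.sqrt (ρ * a) := by
    rw [show 8 * Real.pi * ρ * a = (2 ^ 2 * 2) * Real.pi * (ρ * a) by ring,
      Real.sqrt_mul (by positivity), Real.sqrt_mul (by positivity), Real.sqrt_mul (by positivity),
      Real.sqrt_sq (by norm_num)]
  have h3 : Real.sqrt (ρ * a ^ 3) = a * Real.sqrt (ρ * a) := by
    rw [show ρ * a ^ 3 = a ^ 2 * (ρ * a) by ring, Real.sqrt_mul (by positivity), Real.sqrt_sq ha.le]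
  have hs2 : Real.sqrt 2 ^ 2 = 2 := Real.sq_sqrt (by norm_num)
  have hsπ : Real.sqrt Real.pi ^ 2 = Real.pi := Real.sq_sqrt hpi.le
  have hsπ0 : 0 < Real.sqrt Real.pi := Real.sqrt_pos.2 hpi
  unfold lhyConstant
  rw [h8, h3]
  field_simp
  rw [hs2, hsπ]
  ring

/-- **The Lee–Huang–Yang integral.** For `ρ, a > 0`, with `lhyConstant = 128/(15√π)`:
`½ (2π)⁻³ ∫_{ℝ³} (√(|p|⁴ + 16πρa|p|²) - |p|² - 8πρa + (8πρa)²/(2|p|²)) dp = 4πρ²a · lhyConstant · √(ρa³)`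
— minus one half of the Bogoliubov zero-point sum `∑_p (p² + 8πρa - √(p⁴+16πρa p²) - (8πρa)²/(2p²))`
per unit volume, in the thermodynamic limit, is the Lee–Huang–Yang term
`4πρ²a · (128/(15√π))√(ρa³)` of `e(ρ)` (units `ħ = 2m = 1`, scattering length entering through
`ĝ(0) = 8πa`). [cite: FournaisEtAl2024, Lemma 8.1 (proof) and Cor. 2.13] -/
theorem lhy_correction_integral {ρ a : ℝ} (hρ : 0 < ρ) (ha : 0 < a) :
    1 / 2 * ((2 * Real.pi) ^ 3)⁻¹ * ∫ p : Space,
        (Real.sqrt (‖p‖ ^ 4 + 16 * Real.pi * ρ * a * ‖p‖ ^ 2) - ‖p‖ ^ 2 - 8 * Real.pi * ρ * a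
          + (8 * Real.pi * ρ * a) ^ 2 / (2 * ‖p‖ ^ 2)) =
      4 * Real.pi * ρ ^ 2 * a * lhyConstant * Real.sqrt (ρ * a ^ 3) := by
  have hμ : 0 < 8 * Real.pi * ρ * a := by positivity
  have hfun : (fun p : Space => Real.sqrt (‖p‖ ^ 4 + 16 * Real.pi * ρ * a * ‖p‖ ^ 2) - ‖p‖ ^ 2
      - 8 * Real.pi * ρ * a + (8 * Real.pi * ρ * a) ^ 2 / (2 * ‖p‖ ^ 2)) =
      fun p : Space => Real.sqrt (‖p‖ ^ 4 + 2 * (8 * Real.pi * ρ * a) * ‖p‖ ^ 2) - ‖p‖ ^ 2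
        - (8 * Real.pi * ρ * a) + (8 * Real.pi * ρ * a) ^ 2 / (2 * ‖p‖ ^ 2) := by
    funext p
    ring_nf
  rw [hfun, integral_bogoliubov hμ]
  exact lhy_scalar_identity hρ ha

end Literature.MathematicalPhysics.QuantumManyBody.BoseGas

end
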